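import Literature.AlgebraicGeometry.Resolution.GaloisDegreePDefectless
import Literature.AlgebraicGeometry.Resolution.NormalDegreePDefectlessArtinSchreier
import Literature.AlgebraicGeometry.Resolution.HenselsLemmaProofs
import Literature.AlgebraicGeometry.Resolution.FrobeniusClosedBasesProofs
import HarnessLib

/-!
# Prop. 4.12 (residue degree `p` in equal characteristic): reduction of the discharge to Lemma 4.10 (Kuhlmann 2010)

Topic: `Literature/AlgebraicGeometry/Resolution` (valued function fields). Proof layer for the
named fact `Kuhlmann2010GaloisResidueDegreeEqChar` (`GaloisDegreePDefectless.lean`) = F.-V.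
Kuhlmann, *Elimination of ramification I: The generalized stability theorem*, Trans. AMS 362
(2010) 5697–5727 = arXiv:1003.5678, **Prop. 4.12** in the form consumed on p. 20 (`char K = p`,
`K` algebraically closed, `F` henselized inertially generated of rank one with a
residue-transcendental generator, `E|F` Galois of degree `p` ⇒ `[Ē : F̄] = p`).

The printed proof of Prop. 4.12 (pp. 15–16 of the arXiv version) is already formalised, down to
two named facts, as `Kuhlmann2010Prop41RTEqualChar.of_parts`
(`NormalDegreePDefectlessArtinSchreier.lean`: Lemma 4.9 `F = R + ℘(F)`, the reduction to the
normal form `ϑ^p - ϑ = Σ cᵢuᵢ`, and the two exits "`χ̄ ∉ F̄`. Thus, `[Ē:F̄] ≥ p`" /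
"Hensel's Lemma would yield that `[E:F] < p` … Hence `[Ē:F̄] ≥ p`"), namely

* `Kuhlmann2010Lemma410` (`FrobeniusClosedBases.lean`) — Lemma 4.10 with Lemma 4.7 and [K5]
  Thm. 10: a subring `R ⊆ F` with a lifting of a Frobenius-closed basis, (LFC1)–(LFC3);
* `Kuhlmann2010HenselsLemma` (`HenselLift.lean`) — a henselian field satisfies Hensel's Lemma,
  DISCHARGED as `Kuhlmann2010HenselsLemma_holds` (`HenselsLemmaProofs.lean`).

This file closes the remaining gap between Prop. 4.1 (as vendored: "either `(E|F,v)` is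
defectless or there is a Galois extension `L|K` of degree `p` with non-trivial defect …") and the
residue-degree form of Prop. 4.12: over an algebraically closed `K` the second alternative is
void (`not_isGaloisStep_of_isAlgClosed`), and defectlessness `p = (vE : vF)·[Ē : F̄]` with
`(vE : vF) = 1` (`vF = vK` divisible, §2.5 and Lemma 2.1:
`IsHenselizedInertiallyGeneratedRT.relIndex_valueSubgroup_eq_one`) reads `[Ē : F̄] = p`
("By the fundamental inequality, equality holds", p. 16). Hence the discharge
`Kuhlmann2010GaloisResidueDegreeEqChar_holds` is EXACTLY the discharge of `Kuhlmann2010Lemma410`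
(`Kuhlmann2010GaloisResidueDegreeEqChar.of_lemma410`), which is `Kuhlmann2010Lemma410_holds`
(`FrobeniusClosedBasesProofs.lean`: field of representatives, residue-field embedding, [K5] Thm. 10
through the adic pole filtration, lifted Frobenius-closed basis).

## Content (PROVED)

* `Kuhlmann2010GaloisResidueDegreeEqChar.of_prop41` — Prop. 4.12 (as vendored) from Prop. 4.1
  (residue-transcendental case, char `p`, as vendored); with the converse direction
  `Kuhlmann2010Prop41RTEqualChar.of_residueDegree` of `GaloisDegreePDefectless.lean` the two named
  facts are equivalent.
* `Kuhlmann2010GaloisResidueDegreeEqChar.of_lemma410` — Prop. 4.12 (as vendored) from Lemma 4.10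
  alone (Hensel's Lemma being discharged).
* `Kuhlmann2010GaloisResidueDegreeEqChar_holds` — **the DISCHARGE**.

## Sources

* F.-V. Kuhlmann, *Elimination of ramification I: The generalized stability theorem*, Trans.
  Amer. Math. Soc. 362 (2010) 5697–5727 = arXiv:1003.5678: §1 (1) (fundamental inequality),
  §2.1 Lemma 2.1, §2.5, §4 Prop. 4.1 and Cor. 4.2, §4.2 Lemmas 4.7–4.10, §4.3 Prop. 4.12 and its
  proof (pp. 15–16), §5 p. 20.
-/

noncomputable section

open IsLocalRing

namespace Literature.AlgebraicGeometry.Resolution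

universe u

/-- **Prop. 4.12 (as vendored: `[Ē : F̄] = p`) from Prop. 4.1 (residue-transcendental case of
equal characteristic, as vendored).** Prop. 4.1 gives: `(E|F,v)` is defectless, or there is a
Galois extension `L|K` of degree `p` with non-trivial defect — impossible over the algebraically
closed `K` (`not_isGaloisStep_of_isAlgClosed`; this is how Cor. 4.2 follows from Prop. 4.1: "If
`(K,v)` is a defectless field, then every Galois extension `(E|F,v)` of degree `p` is
defectless"). Defectlessness `p = [E : F] = (vE : vF)·[Ē : F̄]` with `(vE : vF) = 1`
(`IsHenselizedInertiallyGeneratedRT.relIndex_valueSubgroup_eq_one`: `vF = vK` is divisible and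
`vE/vF` is torsion) is `[Ē : F̄] = p`. PROVED.
[cite: Kuhlmann2010, Prop. 4.1, Cor. 4.2 and Prop. 4.12] -/
theorem Kuhlmann2010GaloisResidueDegreeEqChar.of_prop41 (h41 : Kuhlmann2010Prop41RTEqualChar.{u}) :
    Kuhlmann2010GaloisResidueDegreeEqChar.{u} := by
  intro Ω _ _ V p _ _ hp K N N' hK hN hstep
  rcases h41 Ω V p hp K N N' hK hN hstep with hdef | ⟨L, hL, -, -⟩
  · obtain ⟨hNN', hdeg, -⟩ := id hstep
    have hrel : Subfield.relfinrank N N' = p := by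
      rw [Subfield.relfinrank_eq_finrank_of_le hNN', hdeg]
    have hpos : 0 < Subfield.relfinrank N N' := by
      rw [hrel]
      exact hp.pos
    obtain ⟨-, -, heq⟩ := hdef
    rw [hN.relIndex_valueSubgroup_eq_one hK hNN' hpos, one_mul, hrel] at heq
    exact heq.symm
  · exact (not_isGaloisStep_of_isAlgClosed hp.ne_one hK hL).elim

/-- **Prop. 4.12 (as vendored) from Lemma 4.10 alone**: the printed proof of Prop. 4.12
(`Kuhlmann2010Prop41RTEqualChar.of_parts`: Lemma 4.9, the normal form `ϑ^p - ϑ = Σ cᵢuᵢ` over the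
lifted Frobenius-closed basis, Lemma 4.8 and Hensel's Lemma) with Hensel's Lemma discharged
(`Kuhlmann2010HenselsLemma_holds`), followed by `of_prop41`. Thus
`Kuhlmann2010GaloisResidueDegreeEqChar_holds` reduces to (and only to) the discharge of
`Kuhlmann2010Lemma410` (Lemma 4.10 with Lemma 4.7 and [K5] Thm. 10). PROVED.
[cite: Kuhlmann2010, Prop. 4.12 (proof, pp. 15–16) with Lemmas 4.8–4.10] -/
theorem Kuhlmann2010GaloisResidueDegreeEqChar.of_lemma410 (h410 : Kuhlmann2010Lemma410.{u}) :
    Kuhlmann2010GaloisResidueDegreeEqChar.{u} :=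
  Kuhlmann2010GaloisResidueDegreeEqChar.of_prop41
    (Kuhlmann2010Prop41RTEqualChar.of_parts h410 Kuhlmann2010HenselsLemma_holds)

/-- **DISCHARGE of `Kuhlmann2010GaloisResidueDegreeEqChar`** (Kuhlmann 2010, Prop. 4.12 in the form
consumed on p. 20: for `(Ω, V)` algebraically closed with `char Ω = char Ωv = p`, `K ≤ Ω` an
algebraically closed subfield, `N` henselized inertially generated of rank one with a
residue-transcendental generator over `K` and `N ≤ N'` Galois of degree `p`: `[N'v : Nv] = p`).
PROVED along the printed proof: Lemma 4.10 (`Kuhlmann2010Lemma410_holds`), Lemma 4.9, the normal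
form over the lifted Frobenius-closed basis, Lemma 4.8, Hensel's Lemma and the fundamental
inequality (`of_lemma410`). [cite: Kuhlmann2010, Prop. 4.12 (with Lemmas 4.7–4.10, [K5] Thm. 10)] -/
theorem Kuhlmann2010GaloisResidueDegreeEqChar_holds : Kuhlmann2010GaloisResidueDegreeEqChar.{u} :=
  Kuhlmann2010GaloisResidueDegreeEqChar.of_lemma410 Kuhlmann2010Lemma410_holds

end Literature.AlgebraicGeometry.Resolution
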